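import Summits.ABC.ABC.Theorems.IneffectiveSubspaceUniformSadicTowerFourThreeSlotOnePrime
import Summits.ABC.ABC.Theorems.IneffectiveSubspaceUniformSadicTowerFourThreeSlotFermatCatalan
import Summits.ABC.ABC.Theorems.IneffectiveSubspaceUniformSadicTowerFourKillPaths

/-!
# `UniformSadicTowerFour` (stmt-ABC-14937), line `flat-steep-split` (lead c4): the uniform p-adic
# TWO-LOGARITHM bound V of card `three-prime-powers-padic-exponent` implies UPD(1,2), hence rung 3

Lead c4's normal form of the first OPEN rung `W = 3` (`B₃`: abc with a constant `C(ε)` on the cell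
`{ω(abc) ≤ 3}`, `ω` = the number of distinct primes of `abc`) of BoundedOmegaABC — the crux
`UniformSadicTowerFour` modulo the route's crux #6 — is the **one-prime / two-base divisibility
bound** UPD(1,2): for every `ε > 0` there is `C = C(ε)` such that for pairwise distinct primes
`p, q, r` and `Y, Z, t ∈ ℕ`

  `p^t ∣ q^Y r^Z − 1` (with `q^Y r^Z ≥ 2`)  or  `p^t ∣ r^Z − q^Y` (with `q^Y < r^Z`)
  `⟹  p^t ≤ C · (pqr)^(1+ε) · (q^Y r^Z)^ε`

(landed: crux ⟹ UPD(1,2), `onePrimeTwoBase_of_uniformSadicTowerFour`, p155800; UPD(1,2) ⟹ `B₃`,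
`boundedOmegaAt_three_of_onePrimeTwoBase`, p156267; `B₃` ⟹ prime Fermat–Catalan bounded,
`primeFermatCatalan_bounded_of_boundedOmegaAt_three`, p155810).  The idea card
`Summits/ABC/ABC/Ideas/three-prime-powers-padic-exponent.md` isolates as the crux of this cell the
conjecture **V** — a UNIFORM p-adic two-logarithm bound, polylogarithmic in the exponents; in the
present divisibility normalisation: for every `ε > 0` there are `κ, C` with

  `t · log p ≤ (1+ε) · log(pqr) + κ · log(max(Y, Z) + 2) + C`

under the same divisibility hypotheses (the card's statement (V) with `A = 1+ε`: "the `p`-part of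
a difference of two prime powers is `≤ C (pqr)^A B^κ`", `B = max(Y, Z)`; it is Yu's theorem on
p-adic linear forms in two logarithms with the factor `p` replaced by `log p`, i.e. the
two-logarithm prime-argument case of the p-adic Lang–Waldschmidt conjecture).  This file types the
card's support item N2 ("the reduction V ⟹ P3(A+ε) as Lean statements") in the sharper form
V ⟹ UPD(1,2) ⟹ ALL of rung 3 (not only the three-prime-power shape `p^x + q^y = r^z` of P3):

* `onePrimeTwoBase_of_padicTwoLog` — V ⟹ UPD(1,2);
* `boundedOmegaAt_three_of_padicTwoLog` — hence V ⟹ `B₃`;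
* `primeFermatCatalan_bounded_of_onePrimeTwoBase` — UPD(1,2) ⟹ `r^z` is bounded over the prime
  Fermat–Catalan solutions `p^x + q^y = r^z`, `1/x + 1/y + 1/z < 1` (p156267 composed with p155810);
* `not_onePrimeTwoBase_of_threeSlotFamily` — the kill path: the cell crux `ThreeSlotFamily` of
  route `NegOmegaAtlas` (stmt-ABC-1227: for some `δ > 0`, infinitely many abc triples with
  `ω(abc) ≤ 3` and quality `> 1 + δ`) refutes UPD(1,2), through
  `boundedOmegaAt_three_iff_not_threeSlotFamily`.

V and UPD(1,2) are inlined verbatim as the hypotheses `hV`, `hU` (no definitions).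

**Proof of `onePrimeTwoBase_of_padicTwoLog` (the polylog term is absorbed by `(q^Y r^Z)^ε`).**
Fix `ε > 0` and the constants `κ, C` of V at `ε`.  Two elementary facts: (i) `q, r ≥ 2` give
`q^Y r^Z ≥ 2^Y 2^Z ≥ 2^{max(Y,Z)}`, so `H := log(q^Y r^Z) ≥ max(Y, Z) · log 2`
(`max_mul_log_two_le`); (ii) a logarithm is eventually below every linear function: there is
`C₁ = C₁(κ, ε)` with `κ · log(B + 2) ≤ ε · log 2 · B + C₁` for all `B ∈ ℕ` (`mul_log_add_two_le`:
WLOG `κ ≥ 0`; with `η = ε log 2 / (κ + 1)` and `log y ≤ y − 1` at `y = η (B + 2)` one gets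
`κ log(B + 2) ≤ κη (B + 2) − κ (1 + log η)` and `κη ≤ ε log 2`).  Hence
`t log p ≤ (1+ε) log(pqr) + ε H + C + C₁`, and exponentiating (`p^t = exp(t log p)`,
`x^s = exp(s log x)` for `x > 0`, `exp` monotone) gives UPD(1,2) with `C' = exp(C + C₁) > 0`.

Sources: the idea card `Summits/ABC/ABC/Ideas/three-prime-powers-padic-exponent.md` (statement
(V); "What it needs", item N2) and the crux notes of the line (`Cruxes/UniformSadicTowerFour/`,
lead c4: the normal form UPD(1,2)); the real-analysis bookkeeping is elementary [folklore].
Mathlib only (`Real.log_le_sub_one_of_pos`, `Real.log_mul`, `Real.log_pow`, `Real.log_le_log`,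
`Real.exp_log`, `Real.rpow_def_of_pos`, `Real.exp_add`, `Real.exp_le_exp`, `Nat.pow_le_pow_left`,
`Nat.pow_le_pow_right`) plus the landed `boundedOmegaAt_three_of_onePrimeTwoBase`,
`primeFermatCatalan_bounded_of_boundedOmegaAt_three` and
`boundedOmegaAt_three_iff_not_threeSlotFamily`.  No new definitions.  Deliberately NOT here:
V and UPD(1,2) themselves (both OPEN: V is the two-logarithm prime-argument case of the p-adic
Lang–Waldschmidt conjecture and is NOT implied by abc, which on its one-logarithm axis bounds
`t · log p` only linearly in the exponents, whereas UPD(1,2) IS implied by `ABC` —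
`onePrimeTwoBase_of_abc`, p155800; here they appear only as the explicit hypotheses `hV`, `hU`),
the effective two-logarithm wall of Yu 2007 with its factor `p / (log p)²` (the sibling stub of
the line, other file), and the shape P3 in isolation.
-/

noncomputable section

-- `Summit.<Summit>.<Problem>` is the mandated summit-side namespace (CONVENTIONS §2); for the
-- single-conjunct summit `ABC` the two coincide, so the duplicate `ABC.ABC` is deliberate.
set_option linter.dupNamespace false

namespace Summit.ABC.ABC.Theorems.UniformSadicTowerFour.BoundedOmega

open Literature.NumberTheory.DiophantineGeometry (IsABCTriple rad rad_def)
open Summit.ABC.ABC.Theses.NegOmegaAtlas (ThreeSlotFamily)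
open scoped BigOperators

/-! ## Two elementary estimates: the polylog term is absorbed by `(q^Y r^Z)^ε` -/

/-- **Growth lemma.** For `κ : ℝ` and `ε > 0` there is a constant `C₁ = C₁(κ, ε)` with
`κ · log(B + 2) ≤ ε · log 2 · B + C₁` for every `B : ℕ` (a logarithm is eventually below every
linear function).  Proof: replace `κ` by `κ' = max κ 0 ≥ 0` (the left side only grows, as
`log(B + 2) ≥ 0`), put `η = ε log 2 / (κ' + 1) > 0`, so that `κ' η ≤ ε log 2`, and use
`log y ≤ y − 1` at `y = η (B + 2)`: `log(B + 2) ≤ η (B + 2) − 1 − log η`, whence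
`κ' log(B + 2) ≤ κ' η B + (2 κ' η − κ' (1 + log η)) ≤ ε log 2 · B + C₁`. [folklore] -/
private theorem mul_log_add_two_le (κ : ℝ) {ε : ℝ} (hε : 0 < ε) :
    ∃ C₁ : ℝ, ∀ B : ℕ, κ * Real.log ((B + 2 : ℕ) : ℝ) ≤ ε * Real.log 2 * B + C₁ := by
  set κ' : ℝ := max κ 0 with hκ'
  have hκ'0 : 0 ≤ κ' := le_max_right _ _
  have hκκ' : κ ≤ κ' := le_max_left _ _
  have hlog2 : 0 < Real.log 2 := Real.log_pos (by norm_num)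
  set η : ℝ := ε * Real.log 2 / (κ' + 1) with hη
  have hη0 : 0 < η := div_pos (mul_pos hε hlog2) (by linarith)
  have h1 : (κ' + 1) * η = ε * Real.log 2 := by
    rw [hη]; field_simp
  have hκ'η : κ' * η ≤ ε * Real.log 2 := by
    rw [← h1]
    exact mul_le_mul_of_nonneg_right (by linarith) hη0.le
  refine ⟨2 * κ' * η - κ' * (1 + Real.log η), fun B => ?_⟩
  have hB : (0 : ℝ) ≤ B := Nat.cast_nonneg B
  have hcast : ((B + 2 : ℕ) : ℝ) = (B : ℝ) + 2 := by push_cast; ring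
  rw [hcast]
  have hB2 : (0 : ℝ) < (B : ℝ) + 2 := by linarith
  have hlogB : 0 ≤ Real.log ((B : ℝ) + 2) := Real.log_nonneg (by linarith)
  have hmain : Real.log ((B : ℝ) + 2) ≤ η * ((B : ℝ) + 2) - 1 - Real.log η := by
    have h := Real.log_le_sub_one_of_pos (mul_pos hη0 hB2)
    rw [Real.log_mul hη0.ne' hB2.ne'] at h
    linarith
  calc κ * Real.log ((B : ℝ) + 2) ≤ κ' * Real.log ((B : ℝ) + 2) :=
        mul_le_mul_of_nonneg_right hκκ' hlogB
    _ ≤ κ' * (η * ((B : ℝ) + 2) - 1 - Real.log η) := mul_le_mul_of_nonneg_left hmain hκ'0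
    _ = κ' * η * B + (2 * κ' * η - κ' * (1 + Real.log η)) := by ring
    _ ≤ ε * Real.log 2 * B + (2 * κ' * η - κ' * (1 + Real.log η)) := by
        have := mul_le_mul_of_nonneg_right hκ'η hB
        linarith

/-- **Size lemma.** For `q, r ≥ 2` and `Y, Z : ℕ`: `max(Y, Z) · log 2 ≤ log(q^Y r^Z)`, because
`2^{max(Y,Z)} ≤ 2^{Y+Z} = 2^Y 2^Z ≤ q^Y r^Z`. [folklore] -/
private theorem max_mul_log_two_le {q r : ℕ} (hq : 2 ≤ q) (hr : 2 ≤ r) (Y Z : ℕ) :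
    ((max Y Z : ℕ) : ℝ) * Real.log 2 ≤ Real.log ((q ^ Y * r ^ Z : ℕ) : ℝ) := by
  have h1 : 2 ^ max Y Z ≤ q ^ Y * r ^ Z :=
    calc 2 ^ max Y Z ≤ 2 ^ (Y + Z) := Nat.pow_le_pow_right (by norm_num) (by omega)
      _ = 2 ^ Y * 2 ^ Z := pow_add 2 Y Z
      _ ≤ q ^ Y * r ^ Z := Nat.mul_le_mul (Nat.pow_le_pow_left hq Y) (Nat.pow_le_pow_left hr Z)
  have h2 : (2 : ℝ) ^ max Y Z ≤ ((q ^ Y * r ^ Z : ℕ) : ℝ) := by exact_mod_cast h1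
  rw [← Real.log_pow]
  exact Real.log_le_log (by positivity) h2

/-! ## V ⟹ UPD(1,2) ⟹ rung `W = 3` -/

/-- **V_{1+ε} ⟹ UPD(1,2).**  The uniform p-adic two-logarithm bound V of the card
`three-prime-powers-padic-exponent` — for every `ε > 0` there are `κ, C` with
`t · log p ≤ (1+ε) log(pqr) + κ log(max(Y,Z) + 2) + C` whenever `p^t` divides `q^Y r^Z − 1`
(`q^Y r^Z ≥ 2`) or `r^Z − q^Y` (`q^Y < r^Z`), `p, q, r` pairwise distinct primes (polylogarithmic
in the exponents: Yu's theorem with `log p` in place of `p`) — implies the one-prime / two-base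
divisibility bound UPD(1,2): `p^t ≤ C' (pqr)^(1+ε) (q^Y r^Z)^ε` with `C' = C'(ε) > 0`.
Proof: with `B = max(Y, Z)`, `κ log(B + 2) ≤ ε B log 2 + C₁ ≤ ε log(q^Y r^Z) + C₁`
(`mul_log_add_two_le`, `max_mul_log_two_le`), so
`t log p ≤ (1+ε) log(pqr) + ε log(q^Y r^Z) + C + C₁`; exponentiate (`p^t = exp(t log p)`,
`x^s = exp(s log x)` for `x > 0`) with `C' = exp(C + C₁)`. [folklore] -/
theorem onePrimeTwoBase_of_padicTwoLog
    (hV : ∀ ε : ℝ, 0 < ε → ∃ κ C : ℝ, ∀ p q r : ℕ, p.Prime → q.Prime → r.Prime →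
      p ≠ q → p ≠ r → q ≠ r → ∀ Y Z t : ℕ,
      (p ^ t ∣ q ^ Y * r ^ Z - 1 ∧ 2 ≤ q ^ Y * r ^ Z) ∨ (p ^ t ∣ r ^ Z - q ^ Y ∧ q ^ Y < r ^ Z) →
      (t : ℝ) * Real.log p ≤
        (1 + ε) * Real.log (p * q * r : ℕ) + κ * Real.log (max Y Z + 2 : ℕ) + C) :
    ∀ ε : ℝ, 0 < ε → ∃ C : ℝ, 0 < C ∧ ∀ p q r : ℕ, p.Prime → q.Prime → r.Prime →
      p ≠ q → p ≠ r → q ≠ r → ∀ Y Z t : ℕ,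
      (p ^ t ∣ q ^ Y * r ^ Z - 1 ∧ 2 ≤ q ^ Y * r ^ Z) ∨ (p ^ t ∣ r ^ Z - q ^ Y ∧ q ^ Y < r ^ Z) →
      ((p ^ t : ℕ) : ℝ) ≤ C * ((p * q * r : ℕ) : ℝ) ^ (1 + ε) * ((q ^ Y * r ^ Z : ℕ) : ℝ) ^ ε := by
  intro ε hε
  obtain ⟨κ, C, hκC⟩ := hV ε hε
  obtain ⟨C₁, hC₁⟩ := mul_log_add_two_le κ hε
  refine ⟨Real.exp (C + C₁), Real.exp_pos _, ?_⟩
  intro p q r hp hq hr hpq hpr hqr Y Z t hyp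
  have hmain := hκC p q r hp hq hr hpq hpr hqr Y Z t hyp
  have hp0 : (0 : ℝ) < p := by exact_mod_cast hp.pos
  have hM : (0 : ℝ) < ((p * q * r : ℕ) : ℝ) := by
    exact_mod_cast mul_pos (mul_pos hp.pos hq.pos) hr.pos
  have hN : (0 : ℝ) < ((q ^ Y * r ^ Z : ℕ) : ℝ) := by
    exact_mod_cast mul_pos (pow_pos hq.pos Y) (pow_pos hr.pos Z)
  -- the polylog term is absorbed: `κ log(max Y Z + 2) ≤ ε log(q^Y r^Z) + C₁`
  have hkey : κ * Real.log ((max Y Z + 2 : ℕ) : ℝ) ≤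
      ε * Real.log ((q ^ Y * r ^ Z : ℕ) : ℝ) + C₁ := by
    have h1 := hC₁ (max Y Z)
    have h2 := mul_le_mul_of_nonneg_left (max_mul_log_two_le hq.two_le hr.two_le Y Z) hε.le
    linarith
  -- exponentiate
  have hL : ((p ^ t : ℕ) : ℝ) = Real.exp ((t : ℝ) * Real.log p) := by
    rw [Nat.cast_pow, ← Real.log_pow, Real.exp_log (pow_pos hp0 t)]
  have hR : Real.exp (C + C₁) * ((p * q * r : ℕ) : ℝ) ^ (1 + ε) * ((q ^ Y * r ^ Z : ℕ) : ℝ) ^ ε =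
      Real.exp (C + C₁ + Real.log ((p * q * r : ℕ) : ℝ) * (1 + ε) +
        Real.log ((q ^ Y * r ^ Z : ℕ) : ℝ) * ε) := by
    rw [Real.rpow_def_of_pos hM, Real.rpow_def_of_pos hN, ← Real.exp_add, ← Real.exp_add]
  rw [hL, hR, Real.exp_le_exp]
  linarith

/-- **V_{1+ε} ⟹ B₃.** The uniform p-adic two-logarithm bound V implies abc with a constant `C(ε)`
on the cell `{ω(abc) ≤ 3}` — the first open rung `W = 3` of BoundedOmegaABC: V ⟹ UPD(1,2)
(`onePrimeTwoBase_of_padicTwoLog`) ⟹ `B₃` (`boundedOmegaAt_three_of_onePrimeTwoBase`, charging one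
prime with the squaring trick). [folklore] -/
theorem boundedOmegaAt_three_of_padicTwoLog
    (hV : ∀ ε : ℝ, 0 < ε → ∃ κ C : ℝ, ∀ p q r : ℕ, p.Prime → q.Prime → r.Prime →
      p ≠ q → p ≠ r → q ≠ r → ∀ Y Z t : ℕ,
      (p ^ t ∣ q ^ Y * r ^ Z - 1 ∧ 2 ≤ q ^ Y * r ^ Z) ∨ (p ^ t ∣ r ^ Z - q ^ Y ∧ q ^ Y < r ^ Z) →
      (t : ℝ) * Real.log p ≤
        (1 + ε) * Real.log (p * q * r : ℕ) + κ * Real.log (max Y Z + 2 : ℕ) + C) :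
    ∀ ε : ℝ, 0 < ε → ∃ C : ℝ, 0 < C ∧ ∀ a b c : ℕ, IsABCTriple a b c →
      (a * b * c).primeFactors.card ≤ 3 → (c : ℝ) < C * ((rad a b c : ℕ) : ℝ) ^ (1 + ε) :=
  boundedOmegaAt_three_of_onePrimeTwoBase (onePrimeTwoBase_of_padicTwoLog hV)

/-- **UPD(1,2) ⟹ prime Fermat–Catalan bounded.** Under the one-prime / two-base divisibility bound
UPD(1,2), `r^z` is bounded over all solutions of `p^x + q^y = r^z` in primes `p ≠ q`, `r` with
hyperbolic signature `1/x + 1/y + 1/z < 1` (written `yz + xz + xy < xyz`): UPD(1,2) ⟹ `B₃`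
(`boundedOmegaAt_three_of_onePrimeTwoBase`) ⟹ the claim
(`primeFermatCatalan_bounded_of_boundedOmegaAt_three`). [folklore] -/
theorem primeFermatCatalan_bounded_of_onePrimeTwoBase
    (hU : ∀ ε : ℝ, 0 < ε → ∃ C : ℝ, 0 < C ∧ ∀ p q r : ℕ, p.Prime → q.Prime → r.Prime →
      p ≠ q → p ≠ r → q ≠ r → ∀ Y Z t : ℕ,
      (p ^ t ∣ q ^ Y * r ^ Z - 1 ∧ 2 ≤ q ^ Y * r ^ Z) ∨ (p ^ t ∣ r ^ Z - q ^ Y ∧ q ^ Y < r ^ Z) →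
      ((p ^ t : ℕ) : ℝ) ≤ C * ((p * q * r : ℕ) : ℝ) ^ (1 + ε) * ((q ^ Y * r ^ Z : ℕ) : ℝ) ^ ε) :
    ∃ N : ℕ, ∀ p q r x y z : ℕ, p.Prime → q.Prime → r.Prime → p ≠ q → p ^ x + q ^ y = r ^ z →
      y * z + x * z + x * y < x * y * z → r ^ z ≤ N :=
  primeFermatCatalan_bounded_of_boundedOmegaAt_three (boundedOmegaAt_three_of_onePrimeTwoBase hU)

/-- **Kill path.** A three-slot violating family — the cell crux `ThreeSlotFamily` of route
`NegOmegaAtlas` (stmt-ABC-1227): for some `δ > 0` there are infinitely many abc triples with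
`ω(abc) ≤ 3` and quality `> 1 + δ` — refutes UPD(1,2), because UPD(1,2) gives `B₃`
(`boundedOmegaAt_three_of_onePrimeTwoBase`) and `B₃` is `¬ThreeSlotFamily`
(`boundedOmegaAt_three_iff_not_threeSlotFamily`). [folklore] -/
theorem not_onePrimeTwoBase_of_threeSlotFamily (h : ThreeSlotFamily) :
    ¬ ∀ ε : ℝ, 0 < ε → ∃ C : ℝ, 0 < C ∧ ∀ p q r : ℕ, p.Prime → q.Prime → r.Prime →
      p ≠ q → p ≠ r → q ≠ r → ∀ Y Z t : ℕ,
      (p ^ t ∣ q ^ Y * r ^ Z - 1 ∧ 2 ≤ q ^ Y * r ^ Z) ∨ (p ^ t ∣ r ^ Z - q ^ Y ∧ q ^ Y < r ^ Z) →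
      ((p ^ t : ℕ) : ℝ) ≤ C * ((p * q * r : ℕ) : ℝ) ^ (1 + ε) * ((q ^ Y * r ^ Z : ℕ) : ℝ) ^ ε :=
  fun hU => (boundedOmegaAt_three_iff_not_threeSlotFamily.mp
    (boundedOmegaAt_three_of_onePrimeTwoBase hU)) h

end Summit.ABC.ABC.Theorems.UniformSadicTowerFour.BoundedOmega

end
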